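import Summits.AnomalousDissipation.AnomalousDissipation.Theorems.MarginalStabilityChainStrainedLayerLawStubStrainWorkIdentityB
import Summits.AnomalousDissipation.AnomalousDissipation.Theorems.MarginalStabilityChainStrainedLayerLawStubStrainWorkIdentityC
import Mathlib.MeasureTheory.Integral.IntervalIntegral.FundThmCalculus
import HarnessLib

/-!
# Stub `stub_strainWorkIdentity` of line `strain-work-sum-rule` (crux `MarginalStabilityChain.StrainedLayerLaw`,
# stmt-AnomalousDissipation-3007): the ENERGY BUDGET of the stretched shear layer

Support file (`--supports stmt-AnomalousDissipation-3007`) proving the registered stub `stub_strainWorkIdentity`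
BY NAME with its registered signature: for a classical solution `(u, v, p)` of the stretched two-dimensional
Navier–Stokes shear layer system `IsStretchedLayerNSSolutionOn (Ioi 0) ν 1 1 L u v p` (`γ = ΔU = 1`, period
`L > 0`, `ν > 0`) with uniform exponential shear tails `ExpTails (Icc a b) u v` on `[a, b] ⊂ (0, ∞)`,

  `∫⁻_{t ∈ (a,b]} layerDissipation ν L (u t) (v t) < ∞` and
  `L · ∫_{(a,b]} D = ∫_a^b strainWork − (excessEnergy(b) − excessEnergy(a))`,

i.e. `dE/dt = J − L·D` with `E = ½∫∫(u² + v² − ¼)`, `J = ½∫∫(¼ − u² + v²)`, `L·D = ν∫∫|∇(u,v)|²`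
(Majda–Bertozzi 2002, §3.1.1 basic energy identity, with the strain drift and stretching of the stretched class
added). Assembly: the fixed-slice identity (tool file B, `stub_strainWorkIdentity_slice`), time regularity of the
strip functionals (tool file C, `stub_strainWorkIdentity_timeRegularity`), the fundamental theorem of calculus
on `[a, b]`, and Fubini/Tonelli bridges between the line's ITERATED functionals (`strainWork`, `excessEnergy`,
`layerDissipation`) and strip integrals.

References: A. J. Majda, A. L. Bertozzi, *Vorticity and Incompressible Flow*, CUP 2002, §3.1.1 (p. 87–88).
-/

-- `Summit.<Summit>.<Problem>` is the tree's mandated summit-side namespace (CONVENTIONS §2); for this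
-- single-conjunct summit the two coincide, so the duplicate is deliberate.
set_option linter.dupNamespace false

noncomputable section

open scoped Topology ENNReal
open Filter Set Function MeasureTheory

namespace Summit.AnomalousDissipation.AnomalousDissipation.Theorems.StrainedLayerLaw.StrainWorkSumRule

open Literature.Analysis.FluidPDE Literature.Analysis.FluidPDE.StretchedLayer

/-! ## Bridges between the line's iterated functionals and strip integrals -/

section Bridges

/-- For a function integrable on the strip, the iterated integral `∫_{x ∈ (0,L]} ∫_y` is the strip integral
(Fubini). [folklore] -/
theorem integral_iterated_eq_strip {L : ℝ} {F : ℝ × ℝ → ℝ} (hF : IntegrableOn F (Ioc 0 L ×ˢ univ)) :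
    ∫ x in Ioc 0 L, ∫ y, F (x, y) = ∫ q in Ioc 0 L ×ˢ univ, F q := by
  rw [IntegrableOn, volume_restrict_strip] at hF
  rw [volume_restrict_strip, integral_prod _ hF]

/-- The dissipation per unit area of a slice with continuous, strip-integrable squared gradient is the real
number `(ν/L) ∫∫_{(0,L]×ℝ} |∇(u,v)|²` (Tonelli, `0 ≤ ν/L`). [folklore] -/
theorem layerDissipation_eq_ofReal {ν L : ℝ} (hνL : 0 ≤ ν / L) {f g : ℝ → ℝ → ℝ}
    (hc : Continuous (fun q : ℝ × ℝ =>
      dX f q.1 q.2 ^ 2 + dY f q.1 q.2 ^ 2 + dX g q.1 q.2 ^ 2 + dY g q.1 q.2 ^ 2))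
    (hI : IntegrableOn (fun q : ℝ × ℝ =>
      dX f q.1 q.2 ^ 2 + dY f q.1 q.2 ^ 2 + dX g q.1 q.2 ^ 2 + dY g q.1 q.2 ^ 2) (Ioc 0 L ×ˢ univ)) :
    layerDissipation ν L f g = ENNReal.ofReal (ν / L * ∫ q in Ioc 0 L ×ˢ univ,
      (dX f q.1 q.2 ^ 2 + dY f q.1 q.2 ^ 2 + dX g q.1 q.2 ^ 2 + dY g q.1 q.2 ^ 2)) := by
  rw [layerDissipation_def, ENNReal.ofReal_mul hνL]
  congr 1
  have hI' := hI
  rw [IntegrableOn, volume_restrict_strip] at hI'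
  rw [volume_restrict_strip, ofReal_integral_eq_lintegral_ofReal hI'
      (Eventually.of_forall fun q => by simp only [Pi.zero_apply]; positivity),
    lintegral_prod _ (hc.measurable.ennreal_ofReal).aemeasurable]

end Bridges

/-! ## The energy budget -/

section Budget

/-- **Stub 1 — the ENERGY BUDGET of the stretched shear layer** (registered stub `stub_strainWorkIdentity` of
line `strain-work-sum-rule`). For a classical solution of the stretched two-dimensional Navier–Stokes layer
system (`γ = ΔU = 1`, period `L > 0`, viscosity `ν > 0`) on `(0, ∞)` with uniform exponential shear tails on
`[a, b] ⊂ (0, ∞)`: the dissipation `∫⁻_{(a,b]} layerDissipation` is finite and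
`L·∫_a^b D = ∫_a^b J − (E(b) − E(a))` with `J = strainWork`, `E = excessEnergy`; i.e. `dE/dt = J − L·D`,
`L·D = ν∫∫|∇(u,v)|²` (Majda–Bertozzi 2002, §3.1.1 basic energy identity, with the strain drift
`div (u, v − y) = −1` and the stretching `−v·v` added): the slice identity `stub_strainWorkIdentity_slice`,
differentiation of `E` under the integral sign and continuity of `E, J, ∫∫|∇(u,v)|²` on `[a, b]`
(`stub_strainWorkIdentity_timeRegularity`), the fundamental theorem of calculus on `[a, b]`, and Fubini /
Tonelli to pass between the line's iterated functionals and strip integrals. [folklore] -/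
theorem stub_strainWorkIdentity : ∀ (ν L a b : ℝ), 0 < ν → 0 < L → 0 < a → a < b → ∀ (u v p : ℝ → ℝ → ℝ → ℝ),
    IsStretchedLayerNSSolutionOn (Ioi 0) ν 1 1 L u v p → ExpTails (Icc a b) u v →
      ∫⁻ t in Ioc a b, layerDissipation ν L (u t) (v t) ≠ ∞ ∧
      L * (∫⁻ t in Ioc a b, layerDissipation ν L (u t) (v t)).toReal =
        (∫ t in a..b, strainWork L (u t) (v t)) -
          (excessEnergy L (u b) (v b) - excessEnergy L (u a) (v a)) := by
  intro ν L a b hν hL ha hab u v p h hET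
  obtain ⟨C, k, hk, hCk⟩ := hET
  have hpos : ∀ {s : ℝ}, s ∈ Icc a b → 0 < s := fun hs => ha.trans_le hs.1
  have haI : a ∈ Icc a b := left_mem_Icc.2 hab.le
  have hbI : b ∈ Icc a b := right_mem_Icc.2 hab.le
  have hST : ∀ s ∈ Icc a b, SliceTails C k (u s) (v s) := fun s hs => (hCk s hs).1
  have hTd : ∀ s ∈ Icc a b, ∀ x y, |deriv (fun r => u r x y) s| + |deriv (fun r => v r x y) s| ≤
      C * Real.exp (-k * |y|) := by
    intro s hs x y
    have h1 := (hCk s hs).2 x y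
    rwa [dT_of_isOpen isOpen_Ioi u (mem_Ioi.2 (hpos hs)), dT_of_isOpen isOpen_Ioi v (mem_Ioi.2 (hpos hs))]
      at h1
  have hνL : 0 ≤ ν / L := div_nonneg hν.le hL.le
  have hC : 0 ≤ C := (hST a haI).nonneg
  -- the strip functionals
  set E : ℝ → ℝ := fun σ => ∫ q in Ioc 0 L ×ˢ univ, (u σ q.1 q.2 ^ 2 + v σ q.1 q.2 ^ 2 - 1 / 4) / 2
    with hE_def
  set J : ℝ → ℝ := fun σ => ∫ q in Ioc 0 L ×ˢ univ, (1 / 4 - u σ q.1 q.2 ^ 2 + v σ q.1 q.2 ^ 2) / 2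
    with hJ_def
  set X : ℝ → ℝ := fun σ => ∫ q in Ioc 0 L ×ˢ univ, (dX (u σ) q.1 q.2 ^ 2 + dY (u σ) q.1 q.2 ^ 2 +
    dX (v σ) q.1 q.2 ^ 2 + dY (v σ) q.1 q.2 ^ 2) with hX_def
  -- time regularity and the slice identity
  obtain ⟨hDer, hEc, hJc, hXc⟩ := stub_strainWorkIdentity_timeRegularity L a b C k u v ha hab hk
    h.contDiffOn_u h.contDiffOn_v hST hTd
  have hsl := fun s (hs : s ∈ Icc a b) =>
    stub_strainWorkIdentity_slice ν L s C k u v p hL (hpos hs) hk h (hST s hs) (hTd s hs)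
  have hEc' : ContinuousOn E (Icc a b) := hEc
  have hJc' : ContinuousOn J (Icc a b) := hJc
  have hXc' : ContinuousOn X (Icc a b) := hXc
  -- `E′ = J − νX` on `(a, b)` and the fundamental theorem of calculus
  have hDer' : ∀ s ∈ Ioo a b, HasDerivAt E (J s - ν * X s) s := by
    intro s hs
    have h1 : HasDerivAt E _ s := hDer s hs
    have h2 := (hsl s (Ioo_subset_Icc_self hs)).2.2.2
    rw [h2] at h1
    exact h1
  have hJi : IntervalIntegrable J volume a b := hJc'.intervalIntegrable_of_Icc hab.le
  have hXi : IntervalIntegrable X volume a b := hXc'.intervalIntegrable_of_Icc hab.le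
  have hFTC : ∫ s in a..b, (J s - ν * X s) = E b - E a :=
    intervalIntegral.integral_eq_sub_of_hasDerivAt_of_le hab.le hEc' hDer' (hJi.sub (hXi.const_mul ν))
  rw [intervalIntegral.integral_sub hJi (hXi.const_mul ν), intervalIntegral.integral_const_mul] at hFTC
  -- bridges to the line's functionals
  have hJeq : ∀ s ∈ Icc a b, strainWork L (u s) (v s) = J s := fun s hs =>
    integral_iterated_eq_strip (hsl s hs).2.1
  have hEeq : ∀ s ∈ Icc a b, excessEnergy L (u s) (v s) = E s := fun s hs => by
    have hs0 : s ∈ Ioi (0:ℝ) := mem_Ioi.2 (hpos hs)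
    exact integral_iterated_eq_strip (integrableOn_strip_of_abs_le_exp
      (contDiff_energyDensity (h.contDiff_u hs0) (h.contDiff_v hs0)).continuous
      (by positivity : 0 ≤ C / 2) hk fun x _ y => (hST s hs).abs_energyDensity_le x y)
  have hDeq : ∀ s ∈ Icc a b, layerDissipation ν L (u s) (v s) = ENNReal.ofReal (ν / L * X s) := by
    intro s hs
    have hs0 : s ∈ Ioi (0:ℝ) := mem_Ioi.2 (hpos hs)
    have h1 : ContDiff ℝ 1 (fun q : ℝ × ℝ => u s q.1 q.2) := (h.contDiff_u hs0).of_le one_le_two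
    have h2 : ContDiff ℝ 1 (fun q : ℝ × ℝ => v s q.1 q.2) := (h.contDiff_v hs0).of_le one_le_two
    exact layerDissipation_eq_ofReal hνL (((((continuous_dX h1).pow 2).add ((continuous_dY h1).pow 2)).add
      ((continuous_dX h2).pow 2)).add ((continuous_dY h2).pow 2)) (hsl s hs).2.2.1
  -- the time integral of the dissipation is a finite real number
  have hXnn : ∀ s, 0 ≤ X s := fun s =>
    setIntegral_nonneg (measurableSet_Ioc.prod MeasurableSet.univ) fun q _ => by positivity
  have hDint : IntegrableOn (fun s => ν / L * X s) (Ioc a b) :=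
    (continuousOn_const.mul hXc').integrableOn_Icc.mono_set Ioc_subset_Icc_self
  have hlint : ∫⁻ s in Ioc a b, layerDissipation ν L (u s) (v s) =
      ENNReal.ofReal (∫ s in Ioc a b, ν / L * X s) := by
    rw [setLIntegral_congr_fun measurableSet_Ioc (fun s hs => hDeq s (Ioc_subset_Icc_self hs))]
    exact (ofReal_integral_eq_lintegral_ofReal hDint
      (Eventually.of_forall fun s => by simp only [Pi.zero_apply]; exact mul_nonneg hνL (hXnn s))).symm
  have hIval : ∫ s in Ioc a b, ν / L * X s = ν / L * ∫ s in a..b, X s := by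
    rw [MeasureTheory.integral_const_mul, intervalIntegral.integral_of_le hab.le]
  have hInn : 0 ≤ ∫ s in Ioc a b, ν / L * X s :=
    setIntegral_nonneg measurableSet_Ioc fun s _ => mul_nonneg hνL (hXnn s)
  refine ⟨by rw [hlint]; exact ENNReal.ofReal_ne_top, ?_⟩
  rw [hlint, ENNReal.toReal_ofReal hInn, hIval]
  have hJint : ∫ s in a..b, strainWork L (u s) (v s) = ∫ s in a..b, J s :=
    intervalIntegral.integral_congr fun s hs => hJeq s (by rwa [uIcc_of_le hab.le] at hs)
  rw [hJint, hEeq b hbI, hEeq a haI, ← hFTC]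
  field_simp
  ring

end Budget

end Summit.AnomalousDissipation.AnomalousDissipation.Theorems.StrainedLayerLaw.StrainWorkSumRule

end
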